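import Summits.Ventures.Crystal3D.Theses.StickyWulffConstant
import Summits.Ventures.Crystal3D.Theorems.StickyWulffConstantStackingLiminfUniformBoundArith
import Literature.MathematicalPhysics.StatisticalMechanics.BarlowCoordination
import Literature.Geometry.DiscreteGeometry.TriangularLatticeContactBound
import HarnessLib

/-!
# A word-uniform surface rung with constant `∛243`: clusters on ANY Barlow stacking have
# `≤ 6N − ∛243·N^{2/3} + 1` contacts

Route `StickyWulffConstant` of the venture `Summits/Ventures/Crystal3D` (cell `crystal3d-full`),
support toward the crux `StackingLiminf` (item stmt-Ventures-19145: the conjectured SHARP uniform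
constant is `∛432 = 6·2^{1/3} = 7.5595…`).  HONEST FRAMING: an ON-LATTICE bound, uniform in the
stacking word, with the NON-sharp constant `∛243 = 3·∛9 = 6.2403…` (82.5 % of `∛432`); it
supersedes the tree's word-uniform `9/2` (`numContacts_le_of_mem_barlowStacking`,
`StickySpheres/BarlowUniformSurfaceBound.lean`) and the fcc-only `6`
(`StickySpheres/FccLoomisWhitney.lean`).  Nothing off-lattice, nothing about ground states.

**Theorem** (`numContacts_le_of_mem_barlowStacking_cbrt243`). For every Hägg sequence `σ`, every
`N` and every injective `x : Fin N → ℝ³` with all points on `barlowStacking 1 √(2/3) σ`: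
`numContacts x ≤ 6N − ∛243 · N^{2/3} + 1`.  Corollary in the shape of the crux
(`stackingLiminf_rung_cbrt243`): for every `ε > 0`, eventually (uniformly in `σ`)
`(∛243 − ε) N^{2/3} ≤ 6N − numContacts x`.

**Proof (layer decomposition; elementary, ours).** Write `N_k` for the number of balls in layer
`k` and `M = max_k N_k`.  (i) In-layer: the balls of layer `k` sit at distinct points of a
triangular lattice, so by the on-lattice Harborth bound (tree:
`HarborthSpiral.twelve_mul_card_le`) their in-layer contacts `e_k` satisfy
`(3N_k − e_k)² + 3 ≥ 12 N_k`, and `3N_k − e_k ≥ 0`; since `n ↦ √(12n − 3)/n` is decreasing,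
`3N_k − e_k ≥ (N_k/M)·√(12M − 3)`, whence `Σ_k (3N_k − e_k) ≥ (N/M)√(12M − 3)`.
(ii) Cross-layer: a ball has at most three contacts in the layer above and three in the layer
below (`threeOffsets`), so the contacts between layers `k` and `k+1` number `≤ 3·min(N_k, N_{k+1})`;
charging the layers below a largest layer `k₀` from below and those above from above gives
`#cross ≤ 3(N − M)`.  (iii) Hence `D = 6N − C ≥ (N/M)√(12M−3) + 3M =: a + b − 1` with
`a = N√(12M−3)/M`, `b = 3M + 1`, and `27a²b = 27N²(12M−3)(3M+1)/M² ≥ 972 N²` (`M ≥ 1`) while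
`4(a+b)³ − 27a²b = (a − 2b)²(4a + b) ≥ 0`; so `(D + 1)³ ≥ 243 N²`.

WHAT THIS IS NOT: not `StackingLiminf` (constant `∛432`), not a statement about `maxContacts`,
nothing about which stacking is optimal.
-/

noncomputable section

namespace Summit.Ventures.Crystal3D.Theorems

open Finset
open Literature.MathematicalPhysics.StatisticalMechanics (barlowPos barlowStacking IsHaggSeq
  sixOffsets threeOffsets card_threeOffsets dist_barlowPos_eq_iff)
open Literature.Geometry.DiscreteGeometry.HarborthSpiral (Adj adjCount
  twelve_mul_card_le adjCount_eq_two_mul)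

/-- **Word-uniform surface rung with constant `∛243`.** For a Hägg sequence `σ` and an injective
configuration `x : Fin N → ℝ³` on `barlowStacking 1 √(2/3) σ`:
`numContacts x ≤ 6N − ∛243 · N^{2/3} + 1` (all `N`; `∛243 = 3∛9 = 6.2403…`). -/
theorem numContacts_le_of_mem_barlowStacking_cbrt243 (σ : ℤ → ℤ) (hσ : IsHaggSeq σ) {N : ℕ}
    (x : Fin N → EuclideanSpace ℝ (Fin 3)) (hx : Function.Injective x)
    (hmem : ∀ i, x i ∈ barlowStacking 1 (Real.sqrt (2 / 3)) σ) :
    (numContacts x : ℝ) ≤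
      6 * (N : ℝ) - (243 : ℝ) ^ ((1 : ℝ) / 3) * (N : ℝ) ^ ((2 : ℝ) / 3) + 1 := by
  classical
  rcases Nat.eq_zero_or_pos N with rfl | hNpos
  · have h0 : numContacts x = 0 := by
      rw [numContacts, contactPairs, Finset.card_eq_zero, Finset.filter_eq_empty_iff]
      intro p; exact Fin.elim0 p.1
    rw [h0]; simp [Real.zero_rpow (by norm_num : (2 : ℝ) / 3 ≠ 0)]
  have hh : (Real.sqrt (2 / 3)) ^ 2 = 2 / 3 * (1 : ℝ) ^ 2 := by
    rw [Real.sq_sqrt (by norm_num)]; ring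
  -- coordinates
  have hcoord : ∀ i, ∃ k a b : ℤ, x i = barlowPos 1 (Real.sqrt (2 / 3)) σ k a b := fun i => hmem i
  choose k a b hc using hcoord
  have hcoord_inj : ∀ i j, k i = k j → a i = a j → b i = b j → i = j := by
    intro i j h1 h2 h3
    apply hx; rw [hc i, hc j, h1, h2, h3]
  have hshell : ∀ i j, dist (x i) (x j) = 1 →
      (k j = k i ∧ (a i - a j, b i - b j) ∈ sixOffsets) ∨
      (k j = k i + 1 ∧ (a i - a j, b i - b j) ∈ threeOffsets (-σ (k i))) ∨
      (k j = k i - 1 ∧ (a i - a j, b i - b j) ∈ threeOffsets (σ (k i - 1))) := by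
    intro i j hd
    rw [hc i, hc j] at hd
    exact (dist_barlowPos_eq_iff hσ one_pos hh _ _ _ _ _ _).1 hd
  -- ordered contact pairs
  set P : Finset (Fin N × Fin N) :=
    univ.filter fun p => p.1 ≠ p.2 ∧ dist (x p.1) (x p.2) = 1 with hP
  have hPcard : P.card = 2 * numContacts x := by
    rw [← sum_coordination_eq, hP, card_filter, Fintype.sum_prod_type]
    refine sum_congr rfl fun i _ => ?_
    rw [coordination, contactNeighbors, card_filter]
    refine sum_congr rfl fun j _ => ?_
    by_cases hij : j = i
    · subst hij; simp
    · simp [hij, Ne.symm hij]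
  set Pin := P.filter fun p => k p.2 = k p.1 with hPin
  set Pup := P.filter fun p => k p.2 = k p.1 + 1 with hPup
  set Pdn := P.filter fun p => k p.2 = k p.1 - 1 with hPdn
  have hsplit : P.card ≤ Pin.card + Pup.card + Pdn.card := by
    have hsub : P ⊆ Pin ∪ Pup ∪ Pdn := by
      intro p hp
      have hd : dist (x p.1) (x p.2) = 1 := (mem_filter.1 hp).2.2
      rcases hshell p.1 p.2 hd with ⟨h, -⟩ | ⟨h, -⟩ | ⟨h, -⟩
      · exact mem_union_left _ (mem_union_left _ (mem_filter.2 ⟨hp, h⟩))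
      · exact mem_union_left _ (mem_union_right _ (mem_filter.2 ⟨hp, h⟩))
      · exact mem_union_right _ (mem_filter.2 ⟨hp, h⟩)
    calc P.card ≤ (Pin ∪ Pup ∪ Pdn).card := card_le_card hsub
      _ ≤ (Pin ∪ Pup).card + Pdn.card := card_union_le _ _
      _ ≤ Pin.card + Pup.card + Pdn.card := by
          gcongr; exact card_union_le _ _
  have hswap : Pdn.card = Pup.card := by
    refine card_nbij' Prod.swap Prod.swap (fun p hp => ?_) (fun p hp => ?_)
      (fun p _ => Prod.swap_swap p) (fun p _ => Prod.swap_swap p)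
    · obtain ⟨hpP, hk⟩ := mem_filter.1 (mem_coe.1 hp)
      obtain ⟨-, hne, hd⟩ := mem_filter.1 hpP
      refine mem_coe.2 (mem_filter.2 ⟨mem_filter.2 ⟨mem_univ _, ?_, ?_⟩, ?_⟩)
      · exact fun h => hne h.symm
      · rw [Prod.fst_swap, Prod.snd_swap, dist_comm]; exact hd
      · rw [Prod.fst_swap, Prod.snd_swap]; omega
    · obtain ⟨hpP, hk⟩ := mem_filter.1 (mem_coe.1 hp)
      obtain ⟨-, hne, hd⟩ := mem_filter.1 hpP
      refine mem_coe.2 (mem_filter.2 ⟨mem_filter.2 ⟨mem_univ _, ?_, ?_⟩, ?_⟩)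
      · exact fun h => hne h.symm
      · rw [Prod.fst_swap, Prod.snd_swap, dist_comm]; exact hd
      · rw [Prod.fst_swap, Prod.snd_swap]; omega
  -- layer sizes and a largest layer
  set n : ℤ → ℕ := fun κ => (univ.filter fun i : Fin N => k i = κ).card with hn
  set K : Finset ℤ := univ.image k with hK
  have hKne : K.Nonempty := ⟨k ⟨0, hNpos⟩, mem_image_of_mem _ (mem_univ _)⟩
  obtain ⟨κ₀, hκ₀K, hκ₀max⟩ := exists_max_image K n hKne
  obtain ⟨M, hMdef⟩ : ∃ M : ℕ, (univ.filter fun i : Fin N => k i = κ₀).card = M := ⟨_, rfl⟩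
  have hMn : n κ₀ = M := hMdef
  have hnle : ∀ κ, n κ ≤ M := by
    intro κ
    by_cases hκ : κ ∈ K
    · exact hMn ▸ hκ₀max κ hκ
    · have : (univ.filter fun i : Fin N => k i = κ) = ∅ := by
        rw [filter_eq_empty_iff]
        intro i _ hki; exact hκ (hki ▸ mem_image_of_mem _ (mem_univ _))
      simp only [hn, this, card_empty]; exact Nat.zero_le _
  have hM1 : 1 ≤ M := by
    obtain ⟨i, -, hi⟩ := mem_image.1 hκ₀K
    rw [← hMdef]
    exact card_pos.2 ⟨i, mem_filter.2 ⟨mem_univ _, hi⟩⟩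
  have hM1r : (1 : ℝ) ≤ (M : ℝ) := by exact_mod_cast hM1
  have hM0r : (0 : ℝ) < (M : ℝ) := by linarith
  have hsumn : ∑ κ ∈ K, n κ = N := by
    have := card_eq_sum_card_fiberwise (f := k) (s := (univ : Finset (Fin N))) (t := K)
      fun i _ => mem_image_of_mem _ (mem_univ _)
    rw [card_univ, Fintype.card_fin] at this
    exact this.symm
  -- (ii) cross-layer pairs: at most `3 (N − M)` upward pairs
  have hpart : (univ.filter fun i : Fin N => k i < κ₀).card +
      (univ.filter fun i : Fin N => κ₀ < k i).card + M = N := by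
    have h1 := card_filter_add_card_filter_not (s := (univ : Finset (Fin N)))
      (fun i => k i < κ₀)
    have h2 := card_filter_add_card_filter_not
      (s := univ.filter fun i : Fin N => ¬ k i < κ₀) (fun i => κ₀ < k i)
    have e1 : (univ.filter fun i : Fin N => ¬ k i < κ₀).filter (fun i => κ₀ < k i) =
        univ.filter fun i => κ₀ < k i := by
      ext i; simp only [mem_filter, mem_univ, true_and]; omega
    have e2 : (univ.filter fun i : Fin N => ¬ k i < κ₀).filter (fun i => ¬ κ₀ < k i) =
        univ.filter fun i => k i = κ₀ := by
      ext i; simp only [mem_filter, mem_univ, true_and]; omega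
    rw [e1, e2, hMdef] at h2
    simp only [card_univ, Fintype.card_fin] at h1
    omega
  have hthree : ∀ (T : Finset (Fin N)) (f : Fin N → ℤ × ℤ) (τ : ℤ), Set.InjOn f ↑T →
      (∀ j ∈ T, f j ∈ threeOffsets τ) → T.card ≤ 3 := by
    intro T f τ hinj hmaps
    rw [← card_threeOffsets τ]
    exact card_le_card_of_injOn f (fun j hj => hmaps j hj) hinj
  have hup : Pup.card ≤ 3 * (N - M) := by
    set A := Pup.filter fun p => k p.1 < κ₀ with hA
    set B := Pup.filter fun p => ¬ k p.1 < κ₀ with hB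
    have hAB : A.card + B.card = Pup.card := card_filter_add_card_filter_not _
    -- fibres of `A` over the lower ball
    have hAfib : ∀ i ∈ A.image Prod.fst, (A.filter fun p => p.1 = i).card ≤ 3 := by
      intro i _
      set T := (A.filter fun p => p.1 = i).image Prod.snd with hT
      have hTcard : (A.filter fun p => p.1 = i).card = T.card := by
        rw [hT, card_image_of_injOn]
        rintro p hp q hq (h : p.2 = q.2)
        exact Prod.ext (((mem_filter.1 (mem_coe.1 hp)).2).trans
          ((mem_filter.1 (mem_coe.1 hq)).2).symm) h
      have hmemT : ∀ j ∈ T, k j = k i + 1 ∧ (a i - a j, b i - b j) ∈ threeOffsets (-σ (k i)) := by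
        intro j hj
        obtain ⟨p, hp, rfl⟩ := mem_image.1 hj
        obtain ⟨hpA, hpi⟩ := mem_filter.1 hp
        obtain ⟨hpU, -⟩ := mem_filter.1 hpA
        obtain ⟨hpP, hk⟩ := mem_filter.1 hpU
        have hd := (mem_filter.1 hpP).2.2
        rw [hpi] at hk hd
        refine ⟨hk, ?_⟩
        rcases hshell i p.2 hd with ⟨h, -⟩ | ⟨-, h'⟩ | ⟨h, -⟩
        · omega
        · exact h'
        · omega
      rw [hTcard]
      refine hthree T (fun j => (a i - a j, b i - b j)) (-σ (k i)) ?_ fun j hj => (hmemT j hj).2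
      intro j hj j' hj' heq
      simp only [Prod.mk.injEq] at heq
      exact hcoord_inj j j' (((hmemT j (mem_coe.1 hj)).1).trans ((hmemT j' (mem_coe.1 hj')).1).symm)
        (by omega) (by omega)
    -- fibres of `B` over the upper ball
    have hBfib : ∀ j ∈ B.image Prod.snd, (B.filter fun p => p.2 = j).card ≤ 3 := by
      intro j _
      set T := (B.filter fun p => p.2 = j).image Prod.fst with hT
      have hTcard : (B.filter fun p => p.2 = j).card = T.card := by
        rw [hT, card_image_of_injOn]
        rintro p hp q hq (h : p.1 = q.1)
        exact Prod.ext h (((mem_filter.1 (mem_coe.1 hp)).2).trans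
          ((mem_filter.1 (mem_coe.1 hq)).2).symm)
      have hmemT : ∀ i ∈ T, k i = k j - 1 ∧
          (a i - a j, b i - b j) ∈ threeOffsets (-σ (k j - 1)) := by
        intro i hi
        obtain ⟨p, hp, rfl⟩ := mem_image.1 hi
        obtain ⟨hpB, hpj⟩ := mem_filter.1 hp
        obtain ⟨hpU, -⟩ := mem_filter.1 hpB
        obtain ⟨hpP, hk⟩ := mem_filter.1 hpU
        have hd := (mem_filter.1 hpP).2.2
        rw [hpj] at hk hd
        refine ⟨by omega, ?_⟩
        rcases hshell p.1 j hd with ⟨h, -⟩ | ⟨-, h'⟩ | ⟨h, -⟩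
        · omega
        · have : k p.1 = k j - 1 := by omega
          rw [this] at h'; exact h'
        · omega
      rw [hTcard]
      refine hthree T (fun i => (a i - a j, b i - b j)) (-σ (k j - 1)) ?_ fun i hi => (hmemT i hi).2
      intro i hi i' hi' heq
      simp only [Prod.mk.injEq] at heq
      exact hcoord_inj i i' (((hmemT i (mem_coe.1 hi)).1).trans ((hmemT i' (mem_coe.1 hi')).1).symm)
        (by omega) (by omega)
    have hA3 := card_le_mul_card_image A 3 hAfib
    have hB3 := card_le_mul_card_image B 3 hBfib
    have hAimg : (A.image Prod.fst).card ≤ (univ.filter fun i : Fin N => k i < κ₀).card := by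
      refine card_le_card fun i hi => ?_
      obtain ⟨p, hp, rfl⟩ := mem_image.1 hi
      exact mem_filter.2 ⟨mem_univ _, (mem_filter.1 hp).2⟩
    have hBimg : (B.image Prod.snd).card ≤ (univ.filter fun i : Fin N => κ₀ < k i).card := by
      refine card_le_card fun j hj => ?_
      obtain ⟨p, hp, rfl⟩ := mem_image.1 hj
      obtain ⟨hpU, hlt⟩ := mem_filter.1 hp
      have hk := (mem_filter.1 hpU).2
      exact mem_filter.2 ⟨mem_univ _, by omega⟩
    omega
  -- (i) in-layer pairs, layer by layer
  set pin : ℤ → ℕ := fun κ => (Pin.filter fun p => k p.1 = κ).card with hpin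
  have hPin_sum : Pin.card = ∑ κ ∈ K, pin κ :=
    card_eq_sum_card_fiberwise (f := fun p => k p.1) (s := Pin) (t := K)
      fun p _ => mem_image_of_mem _ (mem_univ _)
  -- the label set of layer `κ`
  set S : ℤ → Finset (ℤ × ℤ) := fun κ =>
    (univ.filter fun i : Fin N => k i = κ).image fun i => (a i, b i) with hS
  have hSinj : ∀ κ, Set.InjOn (fun i => (a i, b i)) ↑(univ.filter fun i : Fin N => k i = κ) := by
    intro κ i hi j hj heq
    simp only [Prod.mk.injEq] at heq
    have hki := (mem_filter.1 (mem_coe.1 hi)).2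
    have hkj := (mem_filter.1 (mem_coe.1 hj)).2
    exact hcoord_inj i j (hki.trans hkj.symm) heq.1 heq.2
  have hScard : ∀ κ, (S κ).card = n κ := fun κ => card_image_of_injOn (hSinj κ)
  have hpin_le : ∀ κ, pin κ ≤ adjCount (S κ) := by
    intro κ
    set L := univ.filter fun i : Fin N => k i = κ with hL
    have hfib : pin κ = ∑ i ∈ L, ((Pin.filter fun p => k p.1 = κ).filter fun p => p.1 = i).card :=
      card_eq_sum_card_fiberwise (f := Prod.fst) (s := Pin.filter fun p => k p.1 = κ) (t := L)
        fun p hp => mem_filter.2 ⟨mem_univ _, (mem_filter.1 hp).2⟩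
    have hle : ∀ i ∈ L, ((Pin.filter fun p => k p.1 = κ).filter fun p => p.1 = i).card ≤
        ((S κ).filter (Adj (a i, b i))).card := by
      intro i hi
      have hki : k i = κ := (mem_filter.1 hi).2
      refine card_le_card_of_injOn (fun p => (a p.2, b p.2)) (fun p hp => ?_) ?_
      · obtain ⟨hp1, hpi⟩ := mem_filter.1 hp
        obtain ⟨hp2, hpκ⟩ := mem_filter.1 hp1
        obtain ⟨hpP, hkk⟩ := mem_filter.1 hp2
        have hd := (mem_filter.1 hpP).2.2
        rw [mem_coe, mem_filter]
        refine ⟨mem_image.2 ⟨p.2, mem_filter.2 ⟨mem_univ _, by omega⟩, rfl⟩, ?_⟩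
        rw [hpi] at hd
        rcases hshell i p.2 hd with ⟨-, h6⟩ | ⟨h, -⟩ | ⟨h, -⟩
        · exact (mem_sixOffsets_iff_adj _ _ _ _).1 h6
        · omega
        · omega
      · intro p hp q hq heq
        simp only [Prod.mk.injEq] at heq
        obtain ⟨hp1, hpi⟩ := mem_filter.1 (mem_coe.1 hp)
        obtain ⟨hq1, hqi⟩ := mem_filter.1 (mem_coe.1 hq)
        obtain ⟨hp2, hpκ⟩ := mem_filter.1 hp1
        obtain ⟨hq2, hqκ⟩ := mem_filter.1 hq1
        have hkp := (mem_filter.1 hp2).2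
        have hkq := (mem_filter.1 hq2).2
        have h2 : p.2 = q.2 := hcoord_inj p.2 q.2 (by omega) heq.1 heq.2
        exact Prod.ext (hpi.trans hqi.symm) h2
    have hreindex : ∑ i ∈ L, ((S κ).filter (Adj (a i, b i))).card = adjCount (S κ) := by
      rw [adjCount_eq_sum]
      have hSκ : S κ = L.image (fun i => (a i, b i)) := rfl
      rw [hSκ]
      exact (sum_image (f := fun q => ((L.image (fun i => (a i, b i))).filter (Adj q)).card)
        fun i hi j hj h => hSinj κ (mem_coe.2 hi) (mem_coe.2 hj) h).symm
    rw [hfib, ← hreindex]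
    exact sum_le_sum hle
  -- Harborth per layer, in the form `d_κ ≥ n_κ t / M`
  obtain ⟨t, ht0, ht2⟩ : ∃ t : ℝ, 0 ≤ t ∧ t ^ 2 = 12 * (M : ℝ) - 3 :=
    ⟨Real.sqrt (12 * (M : ℝ) - 3), Real.sqrt_nonneg _, by rw [Real.sq_sqrt]; linarith⟩
  have hlayer : ∀ κ ∈ K, (n κ : ℝ) * t / M ≤ 3 * (n κ : ℝ) - (pin κ : ℝ) / 2 := by
    intro κ hκ
    have hne : (S κ).Nonempty := by
      rw [← card_pos, hScard]
      obtain ⟨i, -, hi⟩ := mem_image.1 hκ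
      exact card_pos.2 ⟨i, mem_filter.2 ⟨mem_univ _, hi⟩⟩
    obtain ⟨h12, hlt⟩ := twelve_mul_card_le (S κ) hne
    have h2e := adjCount_eq_two_mul (S κ)
    set e := Literature.Geometry.DiscreteGeometry.HarborthSpiral.horizBonds (S κ) +
      Literature.Geometry.DiscreteGeometry.HarborthSpiral.vertBonds (S κ) +
      Literature.Geometry.DiscreteGeometry.HarborthSpiral.diagBonds (S κ) with he
    rw [hScard κ] at h12 hlt
    have hpe : (pin κ : ℝ) ≤ 2 * (e : ℝ) := by
      have := hpin_le κ; rw [h2e] at this; exact_mod_cast this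
    have h12r : 12 * (n κ : ℝ) ≤ (3 * (n κ : ℝ) - e) ^ 2 + 3 := by exact_mod_cast h12
    have hltr : (e : ℝ) < 3 * (n κ : ℝ) := by exact_mod_cast hlt
    have hnM : (n κ : ℝ) ≤ M := by exact_mod_cast hnle κ
    have hn1 : (1 : ℝ) ≤ n κ := by
      have : 1 ≤ n κ := by rw [← hScard]; exact hne.card_pos
      exact_mod_cast this
    -- the target `d := 3 n − pin/2 ≥ 3 n − e ≥ 0`
    have hd0 : 0 ≤ 3 * (n κ : ℝ) - e := by linarith
    have hsq : ((n κ : ℝ) * t / M) ^ 2 ≤ (3 * (n κ : ℝ) - e) ^ 2 := by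
      rw [div_pow, mul_pow, ht2, div_le_iff₀ (by positivity)]
      -- (12 n − 3) M² − n² (12 M − 3) = 3 (M − n)(4 n M − M − n) ≥ 0
      have hkey : (n κ : ℝ) ^ 2 * (12 * (M : ℝ) - 3) ≤ (12 * (n κ : ℝ) - 3) * (M : ℝ) ^ 2 := by
        nlinarith [mul_nonneg (sub_nonneg.2 hnM) (by nlinarith : (0:ℝ) ≤ 4 * n κ * M - M - n κ)]
      nlinarith
    have hle : (n κ : ℝ) * t / M ≤ 3 * (n κ : ℝ) - e :=
      (pow_le_pow_iff_left₀ (by positivity) hd0 two_ne_zero).1 hsq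
    linarith
  -- summing (i) over the layers
  have hin : (N : ℝ) * t / M ≤ 3 * (N : ℝ) - (Pin.card : ℝ) / 2 := by
    have hs := sum_le_sum hlayer
    have lhs : ∑ κ ∈ K, (n κ : ℝ) * t / M = (N : ℝ) * t / M := by
      rw [← sum_div, ← sum_mul, ← Nat.cast_sum, hsumn]
    have rhs : ∑ κ ∈ K, (3 * (n κ : ℝ) - (pin κ : ℝ) / 2) = 3 * (N : ℝ) - (Pin.card : ℝ) / 2 := by
      rw [sum_sub_distrib, ← mul_sum, ← sum_div, ← Nat.cast_sum, ← Nat.cast_sum, hsumn, hPin_sum]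
    linarith
  -- assemble
  have hMN : M ≤ N := by
    rw [← hMdef]; exact (card_filter_le _ _).trans (by rw [card_univ, Fintype.card_fin])
  have hcnt : 2 * (numContacts x : ℝ) ≤ (Pin.card : ℝ) + 2 * (3 * ((N : ℝ) - M)) := by
    have h1 : 2 * numContacts x ≤ Pin.card + 2 * Pup.card := by rw [← hPcard]; omega
    have h2 : (Pup.card : ℝ) ≤ 3 * ((N : ℝ) - M) := by
      have : (Pup.card : ℝ) ≤ ((3 * (N - M) : ℕ) : ℝ) := by exact_mod_cast hup
      rw [Nat.cast_mul, Nat.cast_sub hMN] at this; exact_mod_cast this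
    have h1r : (2 * numContacts x : ℝ) ≤ (Pin.card : ℝ) + 2 * (Pup.card : ℝ) := by
      exact_mod_cast h1
    linarith
  have hfinal : (243 : ℝ) ^ ((1 : ℝ) / 3) * (N : ℝ) ^ ((2 : ℝ) / 3) - 1 ≤
      (N : ℝ) * t / M + 3 * M :=
    cbrt243_rpow_sub_one_le hM1r (Nat.cast_nonneg N) ht0 ht2
  linarith

/-- The same rung for the venture's unit packings (`IsUnitPacking x` ⇒ `x` injective): on any
Barlow stacking, `numContacts x ≤ 6N − ∛243 · N^{2/3} + 1`. -/
theorem numContacts_le_of_isUnitPacking_barlowStacking_cbrt243 (σ : ℤ → ℤ) (hσ : IsHaggSeq σ)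
    {N : ℕ} (x : Fin N → EuclideanSpace ℝ (Fin 3)) (hx : IsUnitPacking x)
    (hmem : ∀ i, x i ∈ barlowStacking 1 (Real.sqrt (2 / 3)) σ) :
    (numContacts x : ℝ) ≤
      6 * (N : ℝ) - (243 : ℝ) ^ ((1 : ℝ) / 3) * (N : ℝ) ^ ((2 : ℝ) / 3) + 1 :=
  numContacts_le_of_mem_barlowStacking_cbrt243 σ hσ x hx.injective hmem

/-- **The rung in the shape of the crux `StackingLiminf`** (item stmt-Ventures-19145), with the
non-sharp constant `∛243 = 6.2403…` in place of `∛432 = 7.5595…`: for every `ε > 0` there is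
`N₀`, INDEPENDENT of the Hägg word, such that every injective `N`-point configuration (`N ≥ N₀`)
on any Barlow stacking `barlowStacking 1 √(2/3) σ` has
`(∛243 − ε) N^{2/3} ≤ 6N − numContacts`. -/
theorem stackingLiminf_rung_cbrt243 :
    ∀ ε : ℝ, 0 < ε → ∃ N₀ : ℕ, ∀ N : ℕ, N₀ ≤ N → ∀ σ : ℤ → ℤ, IsHaggSeq σ →
      ∀ x : Fin N → EuclideanSpace ℝ (Fin 3), Function.Injective x →
        (∀ i, x i ∈ barlowStacking 1 (Real.sqrt (2 / 3)) σ) →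
          ((243 : ℝ) ^ ((1 : ℝ) / 3) - ε) * (N : ℝ) ^ ((2 : ℝ) / 3) ≤
            6 * (N : ℝ) - (numContacts x : ℝ) := by
  intro ε hε
  obtain ⟨N₀, hN₀⟩ := exists_nat_ge ((1 / ε) ^ ((3 : ℝ) / 2))
  refine ⟨N₀, fun N hN σ hσ x hx hmem => ?_⟩
  have hmain := numContacts_le_of_mem_barlowStacking_cbrt243 σ hσ x hx hmem
  -- `ε N^{2/3} ≥ 1` for `N ≥ (1/ε)^{3/2}`
  have hNr : (1 / ε) ^ ((3 : ℝ) / 2) ≤ (N : ℝ) := hN₀.trans (by exact_mod_cast hN)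
  have hpow : 1 / ε ≤ (N : ℝ) ^ ((2 : ℝ) / 3) := by
    have h := Real.rpow_le_rpow (by positivity) hNr (by norm_num : (0 : ℝ) ≤ (2 : ℝ) / 3)
    rwa [← Real.rpow_mul (by positivity), show ((3 : ℝ) / 2) * ((2 : ℝ) / 3) = 1 by norm_num,
      Real.rpow_one] at h
  have hone : 1 ≤ ε * (N : ℝ) ^ ((2 : ℝ) / 3) := by
    have := mul_le_mul_of_nonneg_left hpow hε.le
    rwa [mul_one_div_cancel hε.ne'] at this
  nlinarith [hmain, hone]

end Summit.Ventures.Crystal3D.Theorems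

end
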